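import Literature.Computability.Cryptography.ChenQuantumLWEChirpBasis
import Literature.Computability.Cryptography.ChenQuantumLWETwoClassLaw

/-!
# The cross-class profile of the chirp-basis reader (T20 — census "profile F" in the kernel)

REPRODUCTION / ANALYSIS OF A CLAIMED RESULT UNDER ADJUDICATION (withdrawn): Yilei Chen, *Quantum
Algorithms for Lattice Problems*, IACR ePrint 2024/555, version of 2024-04-18 [ChenQuantumLattice2024]
(the version carrying the author's note that Step 9 contains a bug), Step 9 (§3.5.9, pp. 34–38) acting
on the line ket `|φ_{b,v′}⟩ = |φ8.b⟩ = Σ_{j ∈ ℤ_P} ψ_P(−j²) |2D²j·b + v′ mod N⟩` (p. 35), secret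
`b = [−1, 2p₁sᵀ, 2p₁eᵀ]ᵀ` of eq. (12) (p. 17), `P = p₁Q` odd, `N = D²P`.  Bundle
`papers/QuantumAdvantage/lwe-quantum-autopsy/`, Part 2 (`REPAIR-CENSUS.md` §1 theorem **T20** and §29;
its hand version is §27.3 "profile F", flagged as hand content by REFEREE remark R-58.1), sequel of
`ChenQuantumLWEChirpBasis.lean` (T18: the chirp-basis reader `offsetReader b` / `datumReader b` of a
KNOWN direction `b` is certain on the line kets of `b`, and datum-certain on those of `b′` iff
`b ≡ b′ (mod Q)`) and of `ChenQuantumLWETwoClassLaw.lean` (T19: the exact two-class law, whose number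
`1/#span(δ)` is the class average of the profile below).  HONEST FRAMING: kernel-checked THEOREMS about
the outcome statistics of one explicit measurement on states occurring in a WITHDRAWN algorithm — the
exact price of running the instance-aware reader of T18 with the WRONG direction — NOT summit progress,
no cryptanalytic claim in either direction, no new algorithm.

## What is proved

Throughout `b, b′` are two directions with heads `b₀ = b′₀ = −1`, `P` is odd, `w′` is any offset,
`δ_i = b_i − b′_i`, and the reader of `b` (`offsetReader b`, outcome `u ∈ ℤ_N^{n+1}`) is applied to the
line ket `|φ_{b′,w′}⟩` of the OTHER direction (squared norm `P`).

**1. The amplitude decomposes over head classes** (`dotProduct_chirpKet_phi8bKet_eq_sum_crossKet`,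
`crossKet_apply_of_ne`, `headPt_injective`).  `⟨φ_{b,u}|φ_{b′,w′}⟩ = Σ_{c ∈ ℤ_P} χ_c(u)` where
`χ_c = crossKet c` is the "line ket" of the DIFFERENCE direction `b′ − b` (head `0`) through the offset
`w′ − 2D²c·b`, with the linear chirp `ψ_P(c² + 2cj)` as coefficients; `χ_c` lives on the outcomes with
head coordinate `u₀ = w′₀ + 2D²c` (`headPt c`), and `c ↦ headPt c` is injective.  So the reader's Born
weight vanishes off these `P` head classes (`offsetReader_weight_eq_zero_of_head`) and on the class of
`c` it is `P⁻¹|χ_c(u)|²` (`dotProduct_chirpKet_phi8bKet_of_head`).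

**2. The head-class law** (`crossKet_normSq`, `sum_weight_headClass`, `sum_weight_headClass_eq_ite`).
The total weight of the head class `c` is the character sum over the PARAMETER STABILISER
`H = {k ∈ ℤ_P : k·δ ≡ 0}`:  `Σ_{u : u₀ = headPt c} ⟨φ′|E_u|φ′⟩ = Σ_{k ∈ H} ψ_P(2ck) = #H·[c·H = 0]`
(orthogonality of a character on a subgroup, `sum_stdAddChar_mul_of_addClosed`).  Normalised by
`‖φ′‖² = P`: the head offset read is `w′₀ + 2D²c` with probability `#H/P` for each of the `P/#H`
classes `c` annihilating `H`, and never anything else.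

**3. The datum marginal — profile F** (`datumReader_cross_weight`, `datumReader_cross_prob`).  With
`2D²p₁` a unit mod `Q`, the datum reader of `b` (T18) outputs the CORRECT datum `w′₀ mod Q` of
`|φ_{b′,w′}⟩` with probability EXACTLY `#ann_Q(δ̄)/Q = 1/#span_Q(δ̄)` (`= gcd(Q, δ)/Q`), where
`δ̄ = δ mod Q` and `ann_Q(δ̄) = {σ ∈ ℤ_Q : σδ̄_i = 0 ∀ i}` (the datum is right iff `Q ∣ c`; summing the
head-class law over `c ∈ Qℤ_P ≅ ℤ_{p₁}` turns `ψ_P` into `ψ_{p₁}` and counts `H ∩ p₁ℤ_P ≅ ann_Q(δ̄)`;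
the two re-parametrisations are `sum_filter_dvd_val` / `card_filter_and_dvd_val`).  The two extreme
cases are T18: probability `1` iff `δ̄ = 0` (same class mod `Q`), and `1/Q` — a uniform guess — as soon
as some `δ̄_i` is a unit.

**4. Inside Chen's class: the number of T19, and the optimum of T13 on average**
(`datumReader_secret_prob`, `datumReader_secret_average`).  For the class members `b + 2p₁s𝟙_U`
(`secretShift`) and `2p₁`, `2D²p₁` units mod `Q`: the reader of the member `s₀` is right on every line
ket of the member `s` with probability `1/#span((s − s₀)|_U)` — the number of T19's two-class law
(`secretSuccess_readout_other`, there for the block read-out averaged over a sub-class, here for the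
chirp reader on EVERY ket) — and its average over the `Q^{#U}` members `s = s₀ + β` is EXACTLY T13's
blind optimum `datumValue Q U`: measuring in the chirp basis of an arbitrary (wrong) class member is an
optimal blind strategy, and "pretending to know the secret" buys nothing beyond `V(Q, U)`.

`Shape` wrappers under `Shape.Admissible`: `Shape.datumReader_cross_prob`.

## What is NOT here

The Step-8 marginal of the head-class law (by the same computation `#(H ∩ Qℤ_P)/p₁`, equal to `1` for
two members of Chen's class — already T11/T17's content); the full joint law of all `n+1` outcome
coordinates beyond the head class masses; approximate / noisy readers; any statement about the
COMPLEXITY of implementing the reader — as in T18, knowing which basis to measure is knowing `b mod Q`.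
-/

namespace Literature.Computability.Cryptography.Chen2024

open scoped BigOperators ComplexOrder
open Matrix

/-! ### 0. Three counting tools: a character on a subgroup, and the multiples of `a` in `ℤ_{am}` -/

/-- **Orthogonality of a character on a subgroup.**  For an additively closed set `H ⊆ ℤ_m` (closed
under `+` and `−`) and `x ∈ ℤ_m`: `Σ_{k ∈ H} ψ_m(xk) = #H` if `x` annihilates `H`, and `0` otherwise
(the sum is invariant under the shift by any `k₀ ∈ H`, which multiplies it by `ψ_m(xk₀)`).
[cite: Korobov1992, Ch. I §1 (orthogonality of characters)] -/
theorem sum_stdAddChar_mul_of_addClosed {m : ℕ} [NeZero m] (p : ZMod m → Prop) [DecidablePred p]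
    (hadd : ∀ a c, p a → p c → p (a + c)) (hsub : ∀ a c, p a → p c → p (a - c)) (x : ZMod m) :
    ∑ k ∈ Finset.univ.filter p, (ZMod.stdAddChar (x * k) : ℂ)
      = if ∀ k, p k → x * k = 0 then (((Finset.univ.filter p).card : ℕ) : ℂ) else 0 := by
  by_cases hall : ∀ k, p k → x * k = 0
  · rw [if_pos hall, Finset.sum_congr rfl fun k hk => by
      rw [hall k (Finset.mem_filter.1 hk).2, AddChar.map_zero_eq_one], Finset.sum_const, nsmul_eq_mul,
      mul_one]
  · rw [if_neg hall]
    push Not at hall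
    obtain ⟨k₀, hk₀, hx⟩ := hall
    set S : ℂ := ∑ k ∈ Finset.univ.filter p, (ZMod.stdAddChar (x * k) : ℂ) with hS
    have hζ : (ZMod.stdAddChar (x * k₀) : ℂ) ≠ 1 := by
      intro h1
      have h2 : (ZMod.stdAddChar (x * k₀) : ℂ) = ZMod.stdAddChar (0 : ZMod m) := by
        rw [h1, AddChar.map_zero_eq_one]
      exact hx (stdAddChar_injective h2)
    have hiff : ∀ k, p (k + k₀) ↔ p k := fun k =>
      ⟨fun h => by simpa using hsub _ _ h hk₀, fun h => hadd _ _ h hk₀⟩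
    have hinv : S = (ZMod.stdAddChar (x * k₀) : ℂ) * S := by
      rw [hS, Finset.sum_filter, Finset.mul_sum]
      conv_lhs => rw [← Equiv.sum_comp (Equiv.addRight k₀)]
      refine Finset.sum_congr rfl fun k _ => ?_
      simp only [Equiv.coe_addRight]
      by_cases hk : p k
      · rw [if_pos ((hiff k).2 hk), if_pos hk, mul_add, AddChar.map_add_eq_mul, mul_comm]
      · rw [if_neg (fun h => hk ((hiff k).1 h)), if_neg hk, mul_zero]
    have hzero : (1 - (ZMod.stdAddChar (x * k₀) : ℂ)) * S = 0 := by linear_combination hinv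
    exact (mul_eq_zero.1 hzero).resolve_left (sub_ne_zero.2 (Ne.symm hζ))

/-- The multiples of `a` in `ℤ_M`, `M = am`, are parametrised WITHOUT REPETITION by `t ∈ ℤ_m ↦ a·t`
(`t` lifted to `[0, m)`): injectivity. [folklore] -/
theorem mulVal_injective {M m : ℕ} [NeZero M] (a : ℕ) (hM : M = a * m) :
    Function.Injective fun t : ZMod m => ((a * t.val : ℕ) : ZMod M) := by
  have ha : 0 < a := Nat.pos_of_ne_zero fun h => NeZero.ne M (by rw [hM, h, zero_mul])
  haveI : NeZero m := ⟨fun h => NeZero.ne M (by rw [hM, h, mul_zero])⟩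
  have hlt : ∀ s : ZMod m, a * s.val < M := fun s => by
    rw [hM]; exact Nat.mul_lt_mul_of_pos_left (ZMod.val_lt s) ha
  intro t t' h
  have h1 : ((a * t.val : ℕ) : ZMod M).val = ((a * t'.val : ℕ) : ZMod M).val := by
    simp only at h
    rw [h]
  rw [ZMod.val_natCast_of_lt (hlt t), ZMod.val_natCast_of_lt (hlt t')] at h1
  exact ZMod.val_injective m (Nat.eq_of_mul_eq_mul_left ha h1)

/-- … and range: `a ∣ c` (for the lift of `c ∈ ℤ_M` to `[0, M)`) iff `c = a·t` for some `t ∈ ℤ_m`.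
[folklore] -/
theorem dvd_val_iff_exists {M m : ℕ} [NeZero M] (a : ℕ) (hM : M = a * m) (c : ZMod M) :
    a ∣ c.val ↔ ∃ t : ZMod m, ((a * t.val : ℕ) : ZMod M) = c := by
  have ha : 0 < a := Nat.pos_of_ne_zero fun h => NeZero.ne M (by rw [hM, h, zero_mul])
  haveI : NeZero m := ⟨fun h => NeZero.ne M (by rw [hM, h, mul_zero])⟩
  constructor
  · rintro ⟨q, hq⟩
    have hqm : q < m := by
      have h := ZMod.val_lt c
      rw [hq, hM] at h
      exact Nat.lt_of_mul_lt_mul_left h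
    refine ⟨(q : ZMod m), ?_⟩
    rw [ZMod.val_natCast_of_lt hqm, ← hq, ZMod.natCast_zmod_val]
  · rintro ⟨t, rfl⟩
    rw [ZMod.val_natCast_of_lt (by rw [hM]; exact Nat.mul_lt_mul_of_pos_left (ZMod.val_lt t) ha)]
    exact Dvd.intro _ rfl

/-- **Summing over the multiples of `a` in `ℤ_{am}`** = summing over `ℤ_m`. [folklore] -/
theorem sum_filter_dvd_val {M m : ℕ} [NeZero M] [NeZero m] (a : ℕ) (hM : M = a * m)
    (g : ZMod M → ℂ) :
    ∑ c ∈ Finset.univ.filter (fun c : ZMod M => a ∣ c.val), g c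
      = ∑ t : ZMod m, g ((a * t.val : ℕ) : ZMod M) := by
  have hset : (Finset.univ.filter fun c : ZMod M => a ∣ c.val)
      = Finset.univ.image fun t : ZMod m => ((a * t.val : ℕ) : ZMod M) := by
    ext c
    rw [Finset.mem_filter, Finset.mem_image]
    simp only [Finset.mem_univ, true_and]
    exact dvd_val_iff_exists a hM c
  rw [hset, Finset.sum_image fun t _ t' _ h => mulVal_injective a hM h]

/-- **Counting the multiples of `a` in `ℤ_{am}` with a property** = counting in `ℤ_m`. [folklore] -/
theorem card_filter_and_dvd_val {M m : ℕ} [NeZero M] [NeZero m] (a : ℕ) (hM : M = a * m)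
    (p : ZMod M → Prop) [DecidablePred p] :
    (Finset.univ.filter fun c : ZMod M => p c ∧ a ∣ c.val).card
      = (Finset.univ.filter fun t : ZMod m => p ((a * t.val : ℕ) : ZMod M)).card := by
  have hset : (Finset.univ.filter fun c : ZMod M => p c ∧ a ∣ c.val)
      = (Finset.univ.filter fun t : ZMod m => p ((a * t.val : ℕ) : ZMod M)).image
          fun t : ZMod m => ((a * t.val : ℕ) : ZMod M) := by
    ext c
    rw [Finset.mem_filter, Finset.mem_image]
    simp only [Finset.mem_univ, true_and, Finset.mem_filter]
    constructor
    · rintro ⟨hp, hdvd⟩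
      obtain ⟨t, rfl⟩ := (dvd_val_iff_exists a hM c).1 hdvd
      exact ⟨t, hp, rfl⟩
    · rintro ⟨t, hp, rfl⟩
      exact ⟨hp, (dvd_val_iff_exists a hM _).2 ⟨t, rfl⟩⟩
  rw [hset, Finset.card_image_of_injective _ (mulVal_injective a hM)]

section CrossClass

variable (n : ℕ) (D p₁ Q : ℕ+) (b : Fin (n + 1) → ℤ)

/-! ### 1. The amplitude of the `b`-reader on a `b′`-ket decomposes over head classes -/

/-- `2D²x ≡ 0 (mod N)` iff `x ≡ 0 (mod P)` (`N = D²P`, `P` odd). [folklore] -/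
theorem twoDsq_mul_eq_zero_iff (hP : Odd ((p₁ * Q : ℕ+) : ℕ)) (x : ℤ) :
    ((2 * ((D : ℕ) : ℤ) ^ 2 * x : ℤ) : ZN D p₁ Q) = 0 ↔ ((x : ℤ) : ZP p₁ Q) = 0 := by
  refine ⟨intCast_ZP_eq_zero_of_twoDsq_mul D p₁ Q hP, fun h => ?_⟩
  rw [ZMod.intCast_zmod_eq_zero_iff_dvd] at h ⊢
  obtain ⟨q, hq⟩ := h
  refine ⟨2 * q, ?_⟩
  rw [hq]
  push_cast
  ring

/-- The HEAD of class `c`: `w′₀ + 2D²c (mod N)` — the head coordinate of every point shared by the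
line `(b′, w′)` and a line of direction `b` at parameter distance `c`. [cite: ChenQuantumLattice2024,
§3.5.9 p. 35] -/
def headPt (w' : Fin (n + 1) → ℤ) (c : ZP p₁ Q) : ZN D p₁ Q :=
  ((w' 0 : ℤ) : ZN D p₁ Q) + ((2 * ((D : ℕ) : ℤ) ^ 2 * ((c.val : ℕ) : ℤ) : ℤ) : ZN D p₁ Q)

/-- `c ↦ headPt c` is injective on `ℤ_P` (`P` odd). [folklore] -/
theorem headPt_injective (hP : Odd ((p₁ * Q : ℕ+) : ℕ)) (w' : Fin (n + 1) → ℤ) :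
    Function.Injective (headPt n D p₁ Q w') := by
  intro c c' h
  unfold headPt at h
  have h1 : ((2 * ((D : ℕ) : ℤ) ^ 2 * (((c.val : ℕ) : ℤ) - ((c'.val : ℕ) : ℤ)) : ℤ) : ZN D p₁ Q)
      = 0 := by
    push_cast at h ⊢
    linear_combination h
  have h2 := (twoDsq_mul_eq_zero_iff D p₁ Q hP _).1 h1
  simp only [Int.cast_sub, Int.cast_natCast, ZMod.natCast_zmod_val] at h2
  linear_combination h2

/-- The offset of the cross ket of class `c`: `w′ − 2D²c·b`. [cite: ChenQuantumLattice2024, §3.5.9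
p. 35] -/
def crossOff (w' : Fin (n + 1) → ℤ) (c : ZP p₁ Q) : Fin (n + 1) → ℤ :=
  fun i => w' i - 2 * ((D : ℕ) : ℤ) ^ 2 * ((c.val : ℕ) : ℤ) * b i

/-- **The cross ket of class `c`**: the "line ket" of the difference direction `b′ − b` (head `0`)
through `w′ − 2D²c·b`, with the LINEAR chirp `ψ_P(c² + 2cj)` as coefficients — the restriction of
`u ↦ ⟨φ_{b,u}|φ_{b′,w′}⟩` to the head class `c`. [cite: ChenQuantumLattice2024, §3.5.9 p. 35;
folklore] -/
noncomputable def crossKet (b' w' : Fin (n + 1) → ℤ) (c : ZP p₁ Q) :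
    Ket (n + 1) ((D * D * (p₁ * Q) : ℕ+) : ℕ) :=
  lineKet (ptB n D p₁ Q (b' - b) (crossOff n D p₁ Q b w' c))
    (fun j => (ZMod.stdAddChar (c ^ 2 + 2 * c * j : ZP p₁ Q) : ℂ))

/-- **Where the lines meet, class by class.**  The point of parameter `j′ + c` on the line `(b, ũ)`
is the point of parameter `j′` on `(b′, w′)` iff `u` is the point of parameter `j′` of the cross line
of class `c`. [cite: ChenQuantumLattice2024, §3.5.9 p. 35; folklore] -/
theorem ptB_liftV_add_eq_iff (b' w' : Fin (n + 1) → ℤ) (u : Fin (n + 1) → ZN D p₁ Q)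
    (c j' : ZP p₁ Q) :
    ptB n D p₁ Q b (liftV n D p₁ Q u) (j' + c) = ptB n D p₁ Q b' w' j'
      ↔ u = ptB n D p₁ Q (b' - b) (crossOff n D p₁ Q b w' c) j' := by
  have hmod : (((j' + c).val : ℕ) : ℤ) ≡ ((j'.val : ℕ) : ℤ) + ((c.val : ℕ) : ℤ)
      [ZMOD (((p₁ * Q : ℕ+) : ℕ) : ℤ)] := by
    refine (ZMod.intCast_eq_intCast_iff _ _ _).1 ?_
    simp only [Int.cast_add, Int.cast_natCast, ZMod.natCast_zmod_val]
  have e : ∀ i, ptB n D p₁ Q b (liftV n D p₁ Q u) (j' + c) i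
      = ((2 * ((D : ℕ) : ℤ) ^ 2 * (((j'.val : ℕ) : ℤ) + ((c.val : ℕ) : ℤ)) * b i : ℤ) : ZN D p₁ Q)
          + u i := by
    intro i
    simp only [ptB]
    rw [Int.cast_add, intCast_liftV, twoDsq_mul_eq_of_modEq D p₁ Q (b i) hmod]
  constructor
  · intro h
    funext i
    have hi := congr_fun h i
    rw [e] at hi
    simp only [ptB, crossOff, Pi.sub_apply] at hi ⊢
    push_cast at hi ⊢
    linear_combination hi
  · intro h
    funext i
    rw [e, h]
    simp only [ptB, crossOff, Pi.sub_apply]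
    push_cast
    ring

/-- **The amplitude decomposes over head classes**: `⟨φ_{b,u}|φ_{b′,w′}⟩ = Σ_{c ∈ ℤ_P} χ_c(u)`
(re-index the double coincidence sum by `j = j′ + c`; the amplitude product `conj ψ_P(−j²)·ψ_P(−j′²)`
is `ψ_P(c² + 2cj′)`). [cite: ChenQuantumLattice2024, §3.5.9 p. 35; folklore] -/
theorem dotProduct_chirpKet_phi8bKet_eq_sum_crossKet (b' w' : Fin (n + 1) → ℤ)
    (u : Fin (n + 1) → ZN D p₁ Q) :
    star (chirpKet n D p₁ Q b u) ⬝ᵥ phi8bKet n D p₁ Q b' w'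
      = ∑ c : ZP p₁ Q, crossKet n D p₁ Q b b' w' c u := by
  unfold chirpKet phi8bKet
  rw [dotProduct_lineKet_lineKet, Finset.sum_comm]
  unfold crossKet lineKet
  conv_rhs => rw [Finset.sum_comm]
  refine Finset.sum_congr rfl fun j' _ => ?_
  conv_lhs => rw [← Equiv.sum_comp (Equiv.addLeft j')]
  refine Finset.sum_congr rfl fun c _ => ?_
  simp only [Equiv.coe_addLeft]
  by_cases h : u = ptB n D p₁ Q (b' - b) (crossOff n D p₁ Q b w' c) j'
  · rw [if_pos ((ptB_liftV_add_eq_iff n D p₁ Q b b' w' u c j').2 h), if_pos h,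
      ← AddChar.map_neg_eq_conj, ← AddChar.map_add_eq_mul]
    congr 1
    ring
  · rw [if_neg (fun h' => h ((ptB_liftV_add_eq_iff n D p₁ Q b b' w' u c j').1 h')), if_neg h]

/-- Every point of the cross line of class `c` has head `headPt c` (`b₀ = b′₀ = −1`).
[cite: ChenQuantumLattice2024, §3.5.9 p. 35, eq. (12) p. 17] -/
theorem ptB_crossOff_head (hb : b 0 = -1) (b' : Fin (n + 1) → ℤ) (hb' : b' 0 = -1)
    (w' : Fin (n + 1) → ℤ) (c j : ZP p₁ Q) :
    ptB n D p₁ Q (b' - b) (crossOff n D p₁ Q b w' c) j 0 = headPt n D p₁ Q w' c := by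
  simp only [ptB, crossOff, headPt, Pi.sub_apply, hb, hb']
  push_cast
  ring

/-- The cross ket of class `c` vanishes off the head class `c`. [folklore] -/
theorem crossKet_apply_of_ne (hb : b 0 = -1) (b' : Fin (n + 1) → ℤ) (hb' : b' 0 = -1)
    (w' : Fin (n + 1) → ℤ) (c : ZP p₁ Q) {u : Fin (n + 1) → ZN D p₁ Q}
    (hu : u 0 ≠ headPt n D p₁ Q w' c) : crossKet n D p₁ Q b b' w' c u = 0 := by
  unfold crossKet
  refine lineKet_apply_of_ne _ _ fun j h => hu ?_
  rw [h, ptB_crossOff_head n D p₁ Q b hb b' hb']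

/-- **On the head class `c` the amplitude IS the cross ket**: `⟨φ_{b,u}|φ_{b′,w′}⟩ = χ_c(u)` when
`u₀ = headPt c`. [cite: ChenQuantumLattice2024, §3.5.9 p. 35; folklore] -/
theorem dotProduct_chirpKet_phi8bKet_of_head (hP : Odd ((p₁ * Q : ℕ+) : ℕ)) (hb : b 0 = -1)
    (b' : Fin (n + 1) → ℤ) (hb' : b' 0 = -1) (w' : Fin (n + 1) → ℤ) (c : ZP p₁ Q)
    {u : Fin (n + 1) → ZN D p₁ Q} (hu : u 0 = headPt n D p₁ Q w' c) :
    star (chirpKet n D p₁ Q b u) ⬝ᵥ phi8bKet n D p₁ Q b' w' = crossKet n D p₁ Q b b' w' c u := by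
  rw [dotProduct_chirpKet_phi8bKet_eq_sum_crossKet]
  refine Finset.sum_eq_single c (fun c' _ hc' => ?_) (fun h => absurd (Finset.mem_univ c) h)
  refine crossKet_apply_of_ne n D p₁ Q b hb b' hb' w' c' fun h => hc' ?_
  exact (headPt_injective n D p₁ Q hP w' (hu.symm.trans h)).symm

/-- **Off the head classes the amplitude vanishes.** [folklore] -/
theorem dotProduct_chirpKet_phi8bKet_eq_zero_of_head (hb : b 0 = -1)
    (b' : Fin (n + 1) → ℤ) (hb' : b' 0 = -1) (w' : Fin (n + 1) → ℤ)
    {u : Fin (n + 1) → ZN D p₁ Q} (hu : ∀ c, u 0 ≠ headPt n D p₁ Q w' c) :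
    star (chirpKet n D p₁ Q b u) ⬝ᵥ phi8bKet n D p₁ Q b' w' = 0 := by
  rw [dotProduct_chirpKet_phi8bKet_eq_sum_crossKet]
  exact Finset.sum_eq_zero fun c _ => crossKet_apply_of_ne n D p₁ Q b hb b' hb' w' c (hu c)

/-- The `b`-reader never outputs an offset whose head is off the `P` classes `w′₀ + 2D²c`.
[cite: ChenQuantumLattice2024, §3.5.9 pp. 35–37; NielsenChuang2010, §2.2.6 p. 90] -/
theorem offsetReader_weight_eq_zero_of_head (hP : Odd ((p₁ * Q : ℕ+) : ℕ)) (hb : b 0 = -1)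
    (b' : Fin (n + 1) → ℤ) (hb' : b' 0 = -1) (w' : Fin (n + 1) → ℤ)
    {u : Fin (n + 1) → ZN D p₁ Q} (hu : ∀ c, u 0 ≠ headPt n D p₁ Q w' c) :
    (offsetReader n D p₁ Q b hP hb).weight (phi8bKet n D p₁ Q b' w') u = 0 := by
  rw [offsetReader_weight, dotProduct_chirpKet_phi8bKet_eq_zero_of_head n D p₁ Q b hb b' hb' w' hu,
    mul_zero, mul_zero]

/-! ### 2. The head-class law: a character sum over the parameter stabiliser -/

/-- The DIRECTION DIFFERENCE mod `P`: `δ_i = b_i − b′_i ∈ ℤ_P`. [folklore] -/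
def dirDiff (b' : Fin (n + 1) → ℤ) (i : Fin (n + 1)) : ZP p₁ Q := ((b i - b' i : ℤ) : ZP p₁ Q)

/-- The DIRECTION DIFFERENCE mod `Q`: `δ̄_i = b_i − b′_i ∈ ℤ_Q` (zero iff `b, b′` are in the same class
mod `Q`, T18). [folklore] -/
def dirDiffQ (b' : Fin (n + 1) → ℤ) (i : Fin (n + 1)) : ZQ Q := ((b i - b' i : ℤ) : ZQ Q)

/-- Two points of the cross line of class `c` coincide iff their parameters differ by an element of the
PARAMETER STABILISER `H = {k : k·δ ≡ 0 (mod P)}`. [cite: ChenQuantumLattice2024, §3.5.9 p. 35; folklore] -/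
theorem ptB_crossOff_eq_iff (hP : Odd ((p₁ * Q : ℕ+) : ℕ)) (b' w' : Fin (n + 1) → ℤ)
    (c j j' : ZP p₁ Q) :
    ptB n D p₁ Q (b' - b) (crossOff n D p₁ Q b w' c) j
        = ptB n D p₁ Q (b' - b) (crossOff n D p₁ Q b w' c) j'
      ↔ ∀ i, (j' - j) * dirDiff n p₁ Q b b' i = 0 := by
  have key : ∀ i, ptB n D p₁ Q (b' - b) (crossOff n D p₁ Q b w' c) j i
        = ptB n D p₁ Q (b' - b) (crossOff n D p₁ Q b w' c) j' i
      ↔ (j' - j) * dirDiff n p₁ Q b b' i = 0 := by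
    intro i
    have hval : ((((((j'.val : ℕ) : ℤ) - ((j.val : ℕ) : ℤ)) * (b i - b' i)) : ℤ) : ZP p₁ Q)
        = (j' - j) * dirDiff n p₁ Q b b' i := by
      simp only [dirDiff, Int.cast_mul, Int.cast_sub, Int.cast_natCast, ZMod.natCast_zmod_val]
    rw [← hval, ← twoDsq_mul_eq_zero_iff D p₁ Q hP]
    simp only [ptB, crossOff, Pi.sub_apply]
    constructor
    · intro h
      push_cast at h ⊢
      linear_combination h
    · intro h
      push_cast at h ⊢
      linear_combination h
  constructor
  · intro h i
    exact (key i).1 (congr_fun h i)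
  · intro h
    funext i
    exact (key i).2 (h i)

/-- **The squared norm of the cross ket is `P` times the character sum over the stabiliser**:
`‖χ_c‖² = P·Σ_{k ∈ H} ψ_P(2ck)` (every point is hit `#H` times; the phases of coinciding points differ
by `ψ_P(2ck)`). [cite: ChenQuantumLattice2024, §3.5.9 p. 35; Korobov1992, Ch. I §1] -/
theorem crossKet_normSq (hP : Odd ((p₁ * Q : ℕ+) : ℕ)) (b' w' : Fin (n + 1) → ℤ) (c : ZP p₁ Q) :
    star (crossKet n D p₁ Q b b' w' c) ⬝ᵥ crossKet n D p₁ Q b b' w' c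
      = (((p₁ * Q : ℕ+) : ℕ) : ℂ)
          * ∑ k ∈ Finset.univ.filter (fun k : ZP p₁ Q => ∀ i, k * dirDiff n p₁ Q b b' i = 0),
              (ZMod.stdAddChar (2 * c * k) : ℂ) := by
  unfold crossKet
  rw [dotProduct_lineKet_lineKet]
  have hinner : ∀ j : ZP p₁ Q,
      (∑ j', if ptB n D p₁ Q (b' - b) (crossOff n D p₁ Q b w' c) j
            = ptB n D p₁ Q (b' - b) (crossOff n D p₁ Q b w' c) j'
          then (starRingEnd ℂ) (ZMod.stdAddChar (c ^ 2 + 2 * c * j : ZP p₁ Q) : ℂ)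
            * (ZMod.stdAddChar (c ^ 2 + 2 * c * j' : ZP p₁ Q) : ℂ) else 0)
        = ∑ k ∈ Finset.univ.filter (fun k : ZP p₁ Q => ∀ i, k * dirDiff n p₁ Q b b' i = 0),
            (ZMod.stdAddChar (2 * c * k) : ℂ) := by
    intro j
    rw [Finset.sum_filter]
    conv_lhs => rw [← Equiv.sum_comp (Equiv.addLeft j)]
    refine Finset.sum_congr rfl fun k _ => ?_
    simp only [Equiv.coe_addLeft]
    by_cases hk : ∀ i, k * dirDiff n p₁ Q b b' i = 0
    · rw [if_pos ((ptB_crossOff_eq_iff n D p₁ Q b hP b' w' c j (j + k)).2 fun i => by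
        rw [add_sub_cancel_left]; exact hk i), if_pos hk, ← AddChar.map_neg_eq_conj,
        ← AddChar.map_add_eq_mul]
      congr 1
      ring
    · rw [if_neg (fun h => hk fun i => by
        have hi := (ptB_crossOff_eq_iff n D p₁ Q b hP b' w' c j (j + k)).1 h i
        rwa [add_sub_cancel_left] at hi), if_neg hk]
  simp_rw [hinner]
  rw [Finset.sum_const, Finset.card_univ, ZMod.card, nsmul_eq_mul]

/-- **The head-class law (character form).**  The total weight of the `b`-reader's outcomes with head
`w′₀ + 2D²c` on `|φ_{b′,w′}⟩` is `Σ_{k ∈ H} ψ_P(2ck)`.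
[cite: ChenQuantumLattice2024, §3.5.9 pp. 35–37; NielsenChuang2010, §2.2.6 p. 90] -/
theorem sum_weight_headClass (hP : Odd ((p₁ * Q : ℕ+) : ℕ)) (hb : b 0 = -1)
    (b' : Fin (n + 1) → ℤ) (hb' : b' 0 = -1) (w' : Fin (n + 1) → ℤ) (c : ZP p₁ Q) :
    ∑ u ∈ Finset.univ.filter (fun u : Fin (n + 1) → ZN D p₁ Q => u 0 = headPt n D p₁ Q w' c),
        (offsetReader n D p₁ Q b hP hb).weight (phi8bKet n D p₁ Q b' w') u
      = ∑ k ∈ Finset.univ.filter (fun k : ZP p₁ Q => ∀ i, k * dirDiff n p₁ Q b b' i = 0),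
          (ZMod.stdAddChar (2 * c * k) : ℂ) := by
  have hP0 : (((p₁ * Q : ℕ+) : ℕ) : ℂ) ≠ 0 := by exact_mod_cast PNat.ne_zero _
  have hw : ∀ u ∈ Finset.univ.filter (fun u : Fin (n + 1) → ZN D p₁ Q => u 0 = headPt n D p₁ Q w' c),
      (offsetReader n D p₁ Q b hP hb).weight (phi8bKet n D p₁ Q b' w') u
        = ((((p₁ * Q : ℕ+) : ℕ) : ℂ))⁻¹
            * ((starRingEnd ℂ) (crossKet n D p₁ Q b b' w' c u) * crossKet n D p₁ Q b b' w' c u) := by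
    intro u hu
    rw [offsetReader_weight,
      dotProduct_chirpKet_phi8bKet_of_head n D p₁ Q b hP hb b' hb' w' c (Finset.mem_filter.1 hu).2]
  rw [Finset.sum_congr rfl hw, ← Finset.mul_sum]
  have hfull : ∑ u ∈ Finset.univ.filter (fun u : Fin (n + 1) → ZN D p₁ Q => u 0 = headPt n D p₁ Q w' c),
      (starRingEnd ℂ) (crossKet n D p₁ Q b b' w' c u) * crossKet n D p₁ Q b b' w' c u
        = star (crossKet n D p₁ Q b b' w' c) ⬝ᵥ crossKet n D p₁ Q b b' w' c := by
    rw [Finset.sum_filter]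
    simp only [dotProduct, Pi.star_apply, Complex.star_def]
    refine Finset.sum_congr rfl fun u _ => ?_
    split_ifs with h
    · rfl
    · rw [crossKet_apply_of_ne n D p₁ Q b hb b' hb' w' c h, mul_zero]
  rw [hfull, crossKet_normSq n D p₁ Q b hP, ← mul_assoc, inv_mul_cancel₀ hP0, one_mul]

/-- **THE HEAD-CLASS LAW (T20, part 1).**  On `|φ_{b′,w′}⟩` the reader of `b` outputs an offset with
head `w′₀ + 2D²c` with total weight `#H` if `c` annihilates the stabiliser `H = {k : k·(b − b′) ≡ 0
(mod P)}`, and `0` otherwise (`‖φ_{b′,w′}‖² = P`, so the probabilities are `#H/P` on `P/#H` classes).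
[cite: ChenQuantumLattice2024, §3.5.9 pp. 35–37; NielsenChuang2010, §2.2.6 p. 90] -/
theorem sum_weight_headClass_eq_ite (hP : Odd ((p₁ * Q : ℕ+) : ℕ)) (hb : b 0 = -1)
    (b' : Fin (n + 1) → ℤ) (hb' : b' 0 = -1) (w' : Fin (n + 1) → ℤ) (c : ZP p₁ Q) :
    ∑ u ∈ Finset.univ.filter (fun u : Fin (n + 1) → ZN D p₁ Q => u 0 = headPt n D p₁ Q w' c),
        (offsetReader n D p₁ Q b hP hb).weight (phi8bKet n D p₁ Q b' w') u
      = if ∀ k : ZP p₁ Q, (∀ i, k * dirDiff n p₁ Q b b' i = 0) → c * k = 0 then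
          (((Finset.univ.filter
              (fun k : ZP p₁ Q => ∀ i, k * dirDiff n p₁ Q b b' i = 0)).card : ℕ) : ℂ)
        else 0 := by
  rw [sum_weight_headClass n D p₁ Q b hP hb b' hb',
    sum_stdAddChar_mul_of_addClosed (fun k : ZP p₁ Q => ∀ i, k * dirDiff n p₁ Q b b' i = 0)
      (fun a a' ha ha' i => by rw [add_mul, ha i, ha' i, add_zero])
      (fun a a' ha ha' i => by rw [sub_mul, ha i, ha' i, sub_zero]) (2 * c)]
  have htwo : IsUnit (2 : ZP p₁ Q) := Literature.NumberTheory.GaussSums.isUnit_two_zmod_of_odd _ hP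
  have hiff : (∀ k : ZP p₁ Q, (∀ i, k * dirDiff n p₁ Q b b' i = 0) → 2 * c * k = 0)
      ↔ ∀ k : ZP p₁ Q, (∀ i, k * dirDiff n p₁ Q b b' i = 0) → c * k = 0 := by
    refine forall_congr' fun k => imp_congr_right fun _ => ?_
    rw [mul_assoc, htwo.mul_right_eq_zero]
  by_cases hc : ∀ k : ZP p₁ Q, (∀ i, k * dirDiff n p₁ Q b b' i = 0) → c * k = 0
  · rw [if_pos hc, if_pos (hiff.2 hc)]
  · rw [if_neg hc, if_neg fun h => hc (hiff.1 h)]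

/-- The squared norm of the measured ket: `‖φ_{b′,w′}‖² = P`. [cite: ChenQuantumLattice2024, §3.5.9
p. 35] -/
theorem phi8bKet_normSq (hP : Odd ((p₁ * Q : ℕ+) : ℕ)) (b' : Fin (n + 1) → ℤ) (hb' : b' 0 = -1)
    (w' : Fin (n + 1) → ℤ) :
    star (phi8bKet n D p₁ Q b' w') ⬝ᵥ phi8bKet n D p₁ Q b' w' = (((p₁ * Q : ℕ+) : ℕ) : ℂ) := by
  rw [dotProduct_phi8bKet_phi8bKet n D p₁ Q b' hP hb', if_pos fun i => rfl]

/-! ### 3. The datum marginal: profile F -/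

/-- The datum of head class `c` is the true datum iff `Q ∣ c` (`2D²` a unit mod `Q`).
[cite: ChenQuantumLattice2024, §3.5.9 p. 37] -/
theorem toDatum_headPt_eq_iff (hunit : IsUnit ((2 * D * D * p₁ : ℕ) : ZQ Q))
    (w' : Fin (n + 1) → ℤ) (c : ZP p₁ Q) :
    toDatum D p₁ Q (headPt n D p₁ Q w' c) = toDatum D p₁ Q ((w' 0 : ℤ) : ZN D p₁ Q)
      ↔ ((Q : ℕ+) : ℕ) ∣ c.val := by
  obtain ⟨u2, hu2⟩ := isUnit_twoDD_modQ D p₁ Q hunit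
  unfold headPt
  rw [map_add, add_eq_left, toDatum_intCast, ← ZMod.natCast_eq_zero_iff]
  have e : ((2 * ((D : ℕ) : ℤ) ^ 2 * ((c.val : ℕ) : ℤ) : ℤ) : ZQ Q)
      = ((2 * D * D : ℕ) : ZQ Q) * ((c.val : ℕ) : ZQ Q) := by
    push_cast
    ring
  rw [e, ← hu2, Units.mul_right_eq_zero]

/-- `p₁ ∣ k` (lift of `k ∈ ℤ_P`) iff `2k ≡ 0 (mod p₁)` (`p₁` odd). [folklore] -/
theorem toPp₁_two_mul_eq_zero_iff (hP : Odd ((p₁ * Q : ℕ+) : ℕ)) (k : ZP p₁ Q) :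
    toPp₁ p₁ Q (2 * k) = 0 ↔ ((p₁ : ℕ+) : ℕ) ∣ k.val := by
  have hp : Odd ((p₁ : ℕ+) : ℕ) := by
    rw [PNat.mul_coe] at hP
    exact Nat.Odd.of_mul_left hP
  have htwo : IsUnit (2 : ZMod ((p₁ : ℕ+) : ℕ)) :=
    Literature.NumberTheory.GaussSums.isUnit_two_zmod_of_odd _ hp
  rw [map_mul, map_ofNat, htwo.mul_right_eq_zero, toPp₁_eq_natCast_val, ZMod.natCast_eq_zero_iff]

/-- The stabiliser condition for a multiple of `p₁`: `(p₁s)·δ_i ≡ 0 (mod P)` iff `s·δ̄_i ≡ 0 (mod Q)`.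
[folklore] -/
theorem p₁_mul_mul_intCast_eq_zero_iff (s : ZQ Q) (z : ℤ) :
    ((((p₁ : ℕ+) : ℕ) * s.val : ℕ) : ZP p₁ Q) * ((z : ℤ) : ZP p₁ Q) = 0
      ↔ s * ((z : ℤ) : ZQ Q) = 0 := by
  have e1 : ((((p₁ : ℕ+) : ℕ) * s.val : ℕ) : ZP p₁ Q) * ((z : ℤ) : ZP p₁ Q)
      = (((((p₁ : ℕ+) : ℕ) : ℤ) * (((s.val : ℕ) : ℤ) * z) : ℤ) : ZP p₁ Q) := by
    push_cast
    ring
  have e2 : s * ((z : ℤ) : ZQ Q) = (((((s.val : ℕ) : ℤ) * z) : ℤ) : ZQ Q) := by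
    simp only [Int.cast_mul, Int.cast_natCast, ZMod.natCast_zmod_val]
  rw [e1, e2, ZMod.intCast_zmod_eq_zero_iff_dvd, ZMod.intCast_zmod_eq_zero_iff_dvd]
  have hPz : (((p₁ * Q : ℕ+) : ℕ) : ℤ) = (((p₁ : ℕ+) : ℕ) : ℤ) * (((Q : ℕ+) : ℕ) : ℤ) := by
    push_cast
    ring
  rw [hPz]
  exact mul_dvd_mul_iff_left (by exact_mod_cast PNat.ne_zero p₁)

/-- **THE DATUM MARGINAL — PROFILE F (T20, part 2; unnormalised).**  For heads `−1`, `P` odd and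
`2D²p₁` a unit mod `Q`: the datum reader of `b` outputs the correct datum `w′₀ mod Q` of `|φ_{b′,w′}⟩`
with total weight `p₁·#ann_Q(δ̄)`, `ann_Q(δ̄) = {σ ∈ ℤ_Q : σ(b_i − b′_i) ≡ 0 (mod Q) ∀ i}`.
[cite: ChenQuantumLattice2024, §3.5.9 pp. 35–37; NielsenChuang2010, §2.2.6 p. 90] -/
theorem datumReader_cross_weight (hP : Odd ((p₁ * Q : ℕ+) : ℕ)) (hb : b 0 = -1)
    (b' : Fin (n + 1) → ℤ) (hb' : b' 0 = -1) (hunit : IsUnit ((2 * D * D * p₁ : ℕ) : ZQ Q))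
    (w' : Fin (n + 1) → ℤ) :
    (datumReader n D p₁ Q b hP hb).weight (phi8bKet n D p₁ Q b' w')
        (toDatum D p₁ Q ((w' 0 : ℤ) : ZN D p₁ Q))
      = (((p₁ : ℕ+) : ℕ) : ℂ)
          * (((Finset.univ.filter
              (fun s : ZQ Q => ∀ i, s * dirDiffQ n Q b b' i = 0)).card : ℕ) : ℂ) := by
  -- abbreviation for the fine weights
  set W : (Fin (n + 1) → ZN D p₁ Q) → ℂ :=
    fun u => (offsetReader n D p₁ Q b hP hb).weight (phi8bKet n D p₁ Q b' w') u with hW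
  have hinj := headPt_injective n D p₁ Q hP w'
  -- step 1: the coarse weight is the sum over the datum fibre
  unfold datumReader
  rw [POVM.map_weight]
  change ∑ u ∈ Finset.univ.filter (fun u : Fin (n + 1) → ZN D p₁ Q =>
      toDatum D p₁ Q (u 0) = toDatum D p₁ Q ((w' 0 : ℤ) : ZN D p₁ Q)), W u = _
  -- step 2: every weight splits over the head classes
  have hsplit : ∀ u, W u = ∑ c : ZP p₁ Q, if u 0 = headPt n D p₁ Q w' c then W u else 0 := by
    intro u
    by_cases hex : ∃ c, u 0 = headPt n D p₁ Q w' c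
    · obtain ⟨c₀, hc₀⟩ := hex
      simp only [hc₀, hinj.eq_iff, Finset.sum_ite_eq, Finset.mem_univ, if_true]
    · push Not at hex
      rw [Finset.sum_congr rfl fun c _ => if_neg (hex c), Finset.sum_const_zero]
      exact offsetReader_weight_eq_zero_of_head n D p₁ Q b hP hb b' hb' w' hex
  rw [Finset.sum_congr rfl fun u _ => hsplit u, Finset.sum_comm]
  -- step 3: a head class is datum-correct iff `Q ∣ c`
  have hclass : ∀ c : ZP p₁ Q,
      (∑ u ∈ Finset.univ.filter (fun u : Fin (n + 1) → ZN D p₁ Q =>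
          toDatum D p₁ Q (u 0) = toDatum D p₁ Q ((w' 0 : ℤ) : ZN D p₁ Q)),
          if u 0 = headPt n D p₁ Q w' c then W u else 0)
        = if ((Q : ℕ+) : ℕ) ∣ c.val then
            ∑ u ∈ Finset.univ.filter
              (fun u : Fin (n + 1) → ZN D p₁ Q => u 0 = headPt n D p₁ Q w' c), W u
          else 0 := by
    intro c
    rw [Finset.sum_filter]
    by_cases hc : ((Q : ℕ+) : ℕ) ∣ c.val
    · rw [if_pos hc, Finset.sum_filter]
      refine Finset.sum_congr rfl fun u _ => ?_
      by_cases hu : u 0 = headPt n D p₁ Q w' c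
      · have hd : toDatum D p₁ Q (u 0) = toDatum D p₁ Q ((w' 0 : ℤ) : ZN D p₁ Q) := by
          rw [hu]
          exact (toDatum_headPt_eq_iff n D p₁ Q hunit w' c).2 hc
        rw [if_pos hd]
      · rw [if_neg hu, ite_self]
    · rw [if_neg hc]
      refine Finset.sum_eq_zero fun u _ => ?_
      by_cases hu : u 0 = headPt n D p₁ Q w' c
      · have hd : ¬ toDatum D p₁ Q (u 0) = toDatum D p₁ Q ((w' 0 : ℤ) : ZN D p₁ Q) := by
          rw [hu]
          exact fun h => hc ((toDatum_headPt_eq_iff n D p₁ Q hunit w' c).1 h)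
        rw [if_neg hd]
      · rw [if_neg hu, ite_self]
  rw [Finset.sum_congr rfl fun c _ => hclass c, ← Finset.sum_filter]
  -- step 4: the head-class law in character form, summed over `c ∈ Qℤ_P ≅ ℤ_{p₁}`
  have hMc : ∀ c : ZP p₁ Q,
      ∑ u ∈ Finset.univ.filter (fun u : Fin (n + 1) → ZN D p₁ Q => u 0 = headPt n D p₁ Q w' c), W u
        = ∑ k ∈ Finset.univ.filter (fun k : ZP p₁ Q => ∀ i, k * dirDiff n p₁ Q b b' i = 0),
            (ZMod.stdAddChar (2 * c * k) : ℂ) :=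
    fun c => sum_weight_headClass n D p₁ Q b hP hb b' hb' w' c
  have hPQ : ((p₁ * Q : ℕ+) : ℕ) = ((Q : ℕ+) : ℕ) * ((p₁ : ℕ+) : ℕ) := by rw [PNat.mul_coe, mul_comm]
  rw [sum_filter_dvd_val ((Q : ℕ+) : ℕ) hPQ]
  simp_rw [hMc]
  have hchar : ∀ (t : ZMod ((p₁ : ℕ+) : ℕ)) (k : ZP p₁ Q),
      (ZMod.stdAddChar (2 * ((((Q : ℕ+) : ℕ) * t.val : ℕ) : ZP p₁ Q) * k) : ℂ)
        = ZMod.stdAddChar (t * toPp₁ p₁ Q (2 * k)) := by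
    intro t k
    have e : (2 * ((((Q : ℕ+) : ℕ) * t.val : ℕ) : ZP p₁ Q) * k : ZP p₁ Q)
        = (((Q : ℕ+) : ℕ) : ZP p₁ Q) * (((t.val : ℕ) : ZP p₁ Q) * (2 * k)) := by
      push_cast
      ring
    rw [e, stdAddChar_Q_mul, map_mul, map_natCast, ZMod.natCast_zmod_val]
  simp_rw [hchar]
  rw [Finset.sum_comm]
  have horth : ∀ k : ZP p₁ Q,
      ∑ t : ZMod ((p₁ : ℕ+) : ℕ), (ZMod.stdAddChar (t * toPp₁ p₁ Q (2 * k)) : ℂ)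
        = if toPp₁ p₁ Q (2 * k) = 0 then (((p₁ : ℕ+) : ℕ) : ℂ) else 0 := by
    intro k
    rw [AddChar.sum_mulShift _ (ZMod.isPrimitive_stdAddChar _), ZMod.card, Nat.cast_ite,
      Nat.cast_zero]
  simp_rw [horth]
  rw [← Finset.sum_filter, Finset.filter_filter, Finset.sum_const, nsmul_eq_mul, mul_comm]
  -- step 5: `H ∩ p₁ℤ_P ≅ ann_Q(δ̄)`
  congr 2
  rw [Finset.filter_congr (q := fun k : ZP p₁ Q =>
      (∀ i, k * dirDiff n p₁ Q b b' i = 0) ∧ ((p₁ : ℕ+) : ℕ) ∣ k.val)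
      (fun k _ => and_congr_right fun _ => toPp₁_two_mul_eq_zero_iff p₁ Q hP k),
    card_filter_and_dvd_val ((p₁ : ℕ+) : ℕ) (PNat.mul_coe p₁ Q)
      (fun k : ZP p₁ Q => ∀ i, k * dirDiff n p₁ Q b b' i = 0)]
  congr 1
  exact Finset.filter_congr fun s _ =>
    forall_congr' fun i => p₁_mul_mul_intCast_eq_zero_iff p₁ Q s (b i - b' i)

/-- **PROFILE F (T20): the exact cross-class success probability of the datum reader.**  For heads
`−1`, `P` odd, `2D²p₁` a unit mod `Q`: the datum reader of `b` is right on `|φ_{b′,w′}⟩` with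
probability `1/#span_Q(b − b′ mod Q)` (`= #ann_Q/Q = gcd(Q, b − b′)/Q`, `inv_card_span_eq`) — `1`
iff `b ≡ b′ (mod Q)` (T18), `1/Q` as soon as one `b_i − b′_i` is a unit mod `Q`.
[cite: ChenQuantumLattice2024, §3.5.9 pp. 35–37; NielsenChuang2010, §2.2.6 p. 90] -/
theorem datumReader_cross_prob (hP : Odd ((p₁ * Q : ℕ+) : ℕ)) (hb : b 0 = -1)
    (b' : Fin (n + 1) → ℤ) (hb' : b' 0 = -1) (hunit : IsUnit ((2 * D * D * p₁ : ℕ) : ZQ Q))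
    (w' : Fin (n + 1) → ℤ) :
    ((datumReader n D p₁ Q b hP hb).weight (phi8bKet n D p₁ Q b' w')
          (toDatum D p₁ Q ((w' 0 : ℤ) : ZN D p₁ Q))).re
        / (star (phi8bKet n D p₁ Q b' w') ⬝ᵥ phi8bKet n D p₁ Q b' w').re
      = ((Nat.card (span Q (dirDiffQ n Q b b')) : ℝ))⁻¹ := by
  rw [datumReader_cross_weight n D p₁ Q b hP hb b' hb' hunit, phi8bKet_normSq n D p₁ Q hP b' hb',
    inv_card_span_eq, Nat.card_eq_fintype_card, Fintype.card_subtype]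
  have hre : ((((p₁ : ℕ+) : ℕ) : ℂ) * (((Finset.univ.filter
      (fun s : ZQ Q => ∀ i, s * dirDiffQ n Q b b' i = 0)).card : ℕ) : ℂ)).re
      = (((p₁ : ℕ+) : ℕ) : ℝ) * ((Finset.univ.filter
          (fun s : ZQ Q => ∀ i, s * dirDiffQ n Q b b' i = 0)).card : ℝ) := by
    rw [← Complex.ofReal_natCast, ← Complex.ofReal_natCast, ← Complex.ofReal_mul, Complex.ofReal_re]
  have hPre : ((((p₁ * Q : ℕ+) : ℕ) : ℂ)).re = (((p₁ : ℕ+) : ℕ) : ℝ) * (((Q : ℕ+) : ℕ) : ℝ) := by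
    rw [← Complex.ofReal_natCast, Complex.ofReal_re]
    push_cast
    ring
  have hp : (((p₁ : ℕ+) : ℕ) : ℝ) ≠ 0 := by exact_mod_cast PNat.ne_zero p₁
  rw [hre, hPre, mul_div_mul_left _ _ hp]

/-! ### 4. Inside Chen's class: the number of T19 and, on average, the optimum of T13 -/

/-- The direction difference mod `Q` of two class members `b + 2p₁s₀𝟙_U`, `b + 2p₁s𝟙_U` is
`2p₁(s₀ − s)` on `U` and `0` off `U`. [cite: ChenQuantumLattice2024, eq. (12) p. 17] -/
theorem dirDiffQ_secretShift (U : Finset (Fin (n + 1))) (s₀ s : Fin (n + 1) → ZQ Q) (i : Fin (n + 1)) :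
    dirDiffQ n Q (b + secretShift n p₁ Q U s₀) (b + secretShift n p₁ Q U s) i
      = if i ∈ U then 2 * (((p₁ : ℕ+) : ℕ) : ZQ Q) * (s₀ i - s i) else 0 := by
  simp only [dirDiffQ, secretShift, classTail, Pi.add_apply]
  split_ifs with hi
  · push_cast [ZMod.natCast_zmod_val]
    ring
  · push_cast
    ring

/-- The annihilator mod `Q` of the difference of two class members is the annihilator of
`(s − s₀)|_U` (`2p₁` a unit mod `Q`). [folklore] -/
theorem filter_ann_secretShift (U : Finset (Fin (n + 1))) (hunit' : IsUnit ((2 * p₁ : ℕ) : ZQ Q))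
    (s₀ s : Fin (n + 1) → ZQ Q) :
    (Finset.univ.filter fun σ : ZQ Q =>
        ∀ i, σ * dirDiffQ n Q (b + secretShift n p₁ Q U s₀) (b + secretShift n p₁ Q U s) i = 0)
      = Finset.univ.filter fun σ : ZQ Q => ∀ i : U, σ * secretDiff n Q U s₀ s i = 0 := by
  obtain ⟨u, hu⟩ := hunit'
  refine Finset.filter_congr fun σ _ => ?_
  simp_rw [dirDiffQ_secretShift]
  constructor
  · intro h i
    have hi := h i
    rw [if_pos i.2] at hi
    have e : σ * (2 * (((p₁ : ℕ+) : ℕ) : ZQ Q) * (s₀ i - s i))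
        = -(((2 * p₁ : ℕ) : ZQ Q) * (σ * secretDiff n Q U s₀ s i)) := by
      simp only [secretDiff]; push_cast; ring
    rw [e, neg_eq_zero, ← hu, Units.mul_right_eq_zero] at hi
    exact hi
  · intro h i
    split_ifs with hi
    · have e : σ * (2 * (((p₁ : ℕ+) : ℕ) : ZQ Q) * (s₀ i - s i))
          = -(((2 * p₁ : ℕ) : ZQ Q) * (σ * secretDiff n Q U s₀ s ⟨i, hi⟩)) := by
        simp only [secretDiff]; push_cast; ring
      rw [e, h ⟨i, hi⟩, mul_zero, neg_zero]
    · exact mul_zero σ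

/-- **The number of T19, ket by ket.**  Inside the class (`b₀ = −1`, `P` odd, `2p₁` and `2D²p₁` units
mod `Q`): the datum reader of the member `b + 2p₁s₀𝟙_U` is right on EVERY line ket of the member
`b + 2p₁s𝟙_U` with probability `1/#span((s − s₀)|_U)` — the number of the two-class law
(`secretSuccess_readout_other`). [cite: ChenQuantumLattice2024, §3.5.9 pp. 35–37, eq. (12) p. 17] -/
theorem datumReader_secret_prob (hP : Odd ((p₁ * Q : ℕ+) : ℕ)) (U : Finset (Fin (n + 1)))
    (hunit : IsUnit ((2 * D * D * p₁ : ℕ) : ZQ Q)) (hunit' : IsUnit ((2 * p₁ : ℕ) : ZQ Q))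
    (s₀ s : Fin (n + 1) → ZQ Q) (w' : Fin (n + 1) → ℤ)
    (h₀ : (b + secretShift n p₁ Q U s₀) 0 = -1) (h₁ : (b + secretShift n p₁ Q U s) 0 = -1) :
    ((datumReader n D p₁ Q (b + secretShift n p₁ Q U s₀) hP h₀).weight
          (phi8bKet n D p₁ Q (b + secretShift n p₁ Q U s) w')
          (toDatum D p₁ Q ((w' 0 : ℤ) : ZN D p₁ Q))).re
        / (star (phi8bKet n D p₁ Q (b + secretShift n p₁ Q U s) w')
            ⬝ᵥ phi8bKet n D p₁ Q (b + secretShift n p₁ Q U s) w').re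
      = ((Nat.card (span Q (secretDiff n Q U s₀ s)) : ℝ))⁻¹ := by
  rw [datumReader_cross_prob n D p₁ Q _ hP h₀ _ h₁ hunit, inv_card_span_eq, inv_card_span_eq,
    Nat.card_eq_fintype_card, Fintype.card_subtype, Nat.card_eq_fintype_card, Fintype.card_subtype,
    filter_ann_secretShift n p₁ Q b U hunit']

/-- The head of a class member is `−1` when `b₀ = −1` and `0 ∉ U`. [cite: ChenQuantumLattice2024,
eq. (12) p. 17] -/
theorem secretShift_head (hb : b 0 = -1) (U : Finset (Fin (n + 1))) (hU : (0 : Fin (n + 1)) ∉ U)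
    (s : Fin (n + 1) → ZQ Q) : (b + secretShift n p₁ Q U s) 0 = -1 := by
  simp only [Pi.add_apply, secretShift, classTail, if_neg hU, Nat.cast_zero, mul_zero, add_zero, hb]

/-- The class member at difference `β ∈ ℤ_Q^U` from `s₀` (equal to `s₀` off `U`). [folklore] -/
def memberAt (U : Finset (Fin (n + 1))) (s₀ : Fin (n + 1) → ZQ Q) (β : U → ZQ Q) :
    Fin (n + 1) → ZQ Q :=
  fun i => if h : i ∈ U then s₀ i + β ⟨i, h⟩ else s₀ i

/-- The secret difference to the member at difference `β` is `β`. [folklore] -/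
theorem secretDiff_memberAt (U : Finset (Fin (n + 1))) (s₀ : Fin (n + 1) → ZQ Q) (β : U → ZQ Q) :
    secretDiff n Q U s₀ (memberAt n Q U s₀ β) = β := by
  funext i
  simp only [secretDiff, memberAt, dif_pos i.2, add_sub_cancel_left, Subtype.coe_eta]

/-- **"Pretending to know the secret" is exactly as good as the blind optimum (T20, part 3).**  Inside
the class (`b₀ = −1`, `0 ∉ U`, `P` odd, `2p₁`, `2D²p₁` units mod `Q`): the success probability of the
datum reader of the member `s₀`, AVERAGED over the `Q^{#U}` members `s₀ + β` (`β ∈ ℤ_Q^U`; any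
offsets `w′_β`), is T13's optimum `V(Q, U) = datumValue Q U` of the BLIND datum read-out
(`datumValue`, `ChenQuantumLWEDatumOptimum`). [cite: ChenQuantumLattice2024, §3.5.9 pp. 35–37,
eq. (12) p. 17] -/
theorem datumReader_secret_average (hP : Odd ((p₁ * Q : ℕ+) : ℕ)) (hb : b 0 = -1)
    (U : Finset (Fin (n + 1))) (hU : (0 : Fin (n + 1)) ∉ U)
    (hunit : IsUnit ((2 * D * D * p₁ : ℕ) : ZQ Q)) (hunit' : IsUnit ((2 * p₁ : ℕ) : ZQ Q))
    (s₀ : Fin (n + 1) → ZQ Q) (w' : (U → ZQ Q) → Fin (n + 1) → ℤ) :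
    (∑ β : U → ZQ Q,
        ((datumReader n D p₁ Q (b + secretShift n p₁ Q U s₀) hP
              (secretShift_head n p₁ Q b hb U hU s₀)).weight
              (phi8bKet n D p₁ Q (b + secretShift n p₁ Q U (memberAt n Q U s₀ β)) (w' β))
              (toDatum D p₁ Q ((w' β 0 : ℤ) : ZN D p₁ Q))).re
          / (star (phi8bKet n D p₁ Q (b + secretShift n p₁ Q U (memberAt n Q U s₀ β)) (w' β))
              ⬝ᵥ phi8bKet n D p₁ Q (b + secretShift n p₁ Q U (memberAt n Q U s₀ β)) (w' β)).re)
        / (((Q : ℕ+) : ℕ) : ℝ) ^ U.card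
      = datumValue Q U := by
  unfold datumValue
  rw [Fintype.card_coe]
  congr 1
  refine Finset.sum_congr rfl fun β _ => ?_
  rw [datumReader_secret_prob n D p₁ Q b hP U hunit hunit' s₀ (memberAt n Q U s₀ β) (w' β)
      (secretShift_head n p₁ Q b hb U hU s₀) (secretShift_head n p₁ Q b hb U hU _),
    secretDiff_memberAt]

end CrossClass

end Literature.Computability.Cryptography.Chen2024

/-! ### 5. For admissible shapes -/

namespace Literature.Computability.Cryptography.Chen2024.Shape

open Literature.Computability.Cryptography.Chen2024

variable (S : Shape)

/-- **T20 for admissible shapes (census row G7, profile F).**  The datum reader of `S.b` applied to a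
line ket of another head-`(−1)` direction `b′` outputs the correct datum with probability exactly
`1/#span_Q(S.b − b′ mod Q)` (`= gcd(Q, S.b − b′)/Q`). [cite: ChenQuantumLattice2024, §3.5.9 pp. 35–37] -/
theorem datumReader_cross_prob (h : S.Admissible) {b' : Fin (S.n + 1) → ℤ} (hb' : b' 0 = -1)
    (w' : Fin (S.n + 1) → ℤ) :
    ((Chen2024.datumReader S.n S.D S.p₁ S.Q S.b h.odd_P h.b_head).weight
          (phi8bKet S.n S.D S.p₁ S.Q b' w') (toDatum S.D S.p₁ S.Q ((w' 0 : ℤ) : ZN S.D S.p₁ S.Q))).re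
        / (star (phi8bKet S.n S.D S.p₁ S.Q b' w') ⬝ᵥ phi8bKet S.n S.D S.p₁ S.Q b' w').re
      = ((Nat.card (span S.Q (dirDiffQ S.n S.Q S.b b')) : ℝ))⁻¹ :=
  Chen2024.datumReader_cross_prob S.n S.D S.p₁ S.Q S.b h.odd_P h.b_head b' hb'
    h.isUnit_twoDDp₁_modQ w'

end Literature.Computability.Cryptography.Chen2024.Shape
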